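import Mathlib
import Literature.MathematicalPhysics.QuantumFieldTheory.Balaban1983to89.B6Prop26ChainGeneric
import Literature.MathematicalPhysics.QuantumFieldTheory.Balaban1983to89.B6Ineq261LevelGap

/-!
# `Balaban1983to89.B6Prop26ChainLevelGap` — [Balaban1984PropagatorsII] the Proposition 2.2 / 2.6 / Corollary 2.8 random-walk
chain with its Lemma-2.1 inputs (2.61)/(2.63) DISCHARGED on EVERY realised contour system with the walk form of (2.2),
geometric bond scales and per-scale packing (constant `K261`), by name from `B6Prop26ChainGeneric` + `B6Ineq261LevelGap`

T. Bałaban, *Propagators and renormalization transformations for lattice gauge theories. II*, Commun. Math. Phys. **96**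
(1984) 223–250 [Balaban1984PropagatorsII] (cell paper B6; PDF held `paper:balaban1984-cmp96-propagators-rt-ii`, journal page
= PDF page + 222; p. 234 = PDF 12 (Lemma 2.1 (2.60)–(2.63)), p. 247 = PDF 25 (Prop. 2.6 (2.133)–(2.136), (2.141): *«reasoning
in the same way as in the proof of Proposition 2.2»*), p. 249 = PDF 27 (Cor. 2.8), p. 238 = PDF 16 ((2.88)); the verbatim
displays are the docstrings of the imported modules `B6RandomWalk`, `B6Prop26`, `B6Prop26Gluing`, `B6Cor28`,
`B6Prop26ChainGeneric`, which this file does NOT modify).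

statement-level skeleton of published theorems with citation tags; proofs where landed; nothing here is a claim about the Yang–Mills mass gap

CITATION HEADER / WHAT IS REPRODUCED.  Mega-formalization `lit-balaban`, HOME `run/shared/lean/pub/lit-balaban/`; Phase-2 proof seat
p29 gen 10 (unit `lit-balaban-p29`, free-target protocol G.5-34(d); TAKING HOME/STATUS 2026-08-21T23:59Z, owner r03 notified).
SKELETON rows **B6.Prop2.6**, **B6.Cor2.8**, **B6.Eq2.64**, **B6.Eq2.88** (cells only, no heads) and **B6.Lem2.1** (consumer side).
CONTEXT.  r03 gen 8's `B6Prop26ChainGeneric` re-derived the Prop 2.2 / 2.6 / Cor 2.8 fixed-point chain for an ARBITRARY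
constant `c` in (2.61)/(2.63) (§2–§4), bound the repaired Lemma 2.1′ (§5) and DISCHARGED the Lemma-2.1 inputs on the multi-level
TOWER family `B6LevelTower.twGeo` (§6: `prop26_chain_2136_tower`, `prop26_entry_of_291_tower`, `cor28_conv_tower`,
`prop26_2136_of_2133_2134_tower`, constant `K_TW`).  Off the towers the row-sum bound was carried as *«the ONLY analytic leaf»*
(`B6Lemma21TwoScale.lemma21TwoScale_of_ineq261T`).  p29 gen 10's `B6Ineq261LevelGap` PROVES (2.61) — hence (2.62)/(2.63) — for
every REALISED contour system (`B6Geometry.Realizes g C`, `C.ι` injective, admissible contours exist) with the walk form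
`B6Geometry.LevelGap C.bond C.zone N` (`N ≥ 1`) of (2.2), bond scales `B6LevelGapMetric.BondScale C.bond C.zone pos ℓ`
(`0 < ℓ n ≤ ℓ(n+1) ≤ L·ℓ n`, `L ≥ 1`) and per-scale packing `|S| ≤ (2R/ℓ j + A)^{dd}`, with the explicit series constant
`K261 N dd L A σ` (finite under `e^{−σ}·L^{2dd/N} < 1`; L-DEPENDENT — honest scope (i) of that file: print's c₁ depends on d, α only).
THIS FILE = r03's §6 block RE-DONE ON THESE GENERAL REALISED GEOMETRIES: the (2.61)/(2.63) inputs of r03's generic theorems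
supplied by `B6Ineq261LevelGap.ineq261With_of_realizes` / `ineq263With_of_realizes` at the chain's rate (constant
`K261 N dd L A (α·rate)`), and (2.54), d(y,y) = 0, d ≥ 0 by `B6Geometry.hyps266_of_realizes`.  r03's file is consumed BY NAME and
not edited (G.5-5).

WHAT THIS FILE PROVES (kernel-checked, zero `sorry`, theorems only — no definition, no named fact; axioms standard).
* **`prop26_chain_2136_levelGap`** — Prop. 2.6's chain ((2.133)/(2.135)-majorants of G₀, R and G = G₀ + GR ⇒ the (2.136) majorant
  `A·K·(1 − θK)⁻¹·P(y)·e^{−δ₃d(y,y′)}`, `K = K261 N dd L A (α·½δ₂)`, δ₃ = `delta3 α δ₂`) on every such realised geometry, under the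
  located smallness `θ·K < 1` and `e^{−α·½δ₂}L^{2dd/N} < 1`.
* **`prop26_entry_of_291_levelGap`** — one entry of (2.136) for a left factor D from (2.91) `Δ_aG₀ = I − R`, `GΔ_a = I`.
* **`cor28_conv_levelGap`** — the two convolution inputs `B6Cor28.Conv263` / `Conv3` of Cor. 2.8 / (2.88) with constants `K²`, `K³`.
* **`prop26_2136_of_2133_2134_levelGap`** — the end-to-end glueing (2.133) + (2.134) + (2.91) ⟹ (2.136) for ANY box family over 𝔅.
HONEST SCOPE.  Exactly as in `B6Prop26ChainGeneric`: nothing here proves (2.133), (2.134), (2.135), (2.91) or the kernel bounds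
of Cor. 2.8 — they stay the displayed OPERATOR hypotheses; what changes is only that the Lemma-2.1 inputs are theorems of the
realised geometry (with an L-dependent constant and the (2.59)-shape condition `e^{−σ}L^{2dd/N} < 1` in place of (2.59)).  The
heads of rows B6.Prop2.6 / B6.Cor2.8 / B6.Eq2.64 / B6.Eq2.88 are unchanged.  NOT summit progress.
-/

namespace Literature.MathematicalPhysics.QuantumFieldTheory.Balaban1983to89.B6Prop26ChainLevelGap

open Finset
open B6RandomWalk (Ineq260 Triangle254 HasMajorant delta3)
open B6Lemma21Repaired (Ineq261With Ineq263With)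
open B6Geometry (ContourSystem Realizes LevelGap hyps266_of_realizes)
open B6LevelGapMetric (BondScale)
open B6Ineq261LevelGap (K261 K261_nonneg summable_K261 partialSum_le_K261 ineq261With_of_realizes ineq263With_of_realizes)
open B6Prop26ChainGeneric (prop26_chain_2136With prop26_entry_of_291With conv263_of_ineq263With conv3_of_ineq263With
  prop26_2136_of_2133_2134With)

noncomputable section

variable {g : B6.Geometry} {Cs : ContourSystem g} {Xp : Type*} [PseudoMetricSpace Xp] {pos : Cs.Pt → Xp} {ℓ : ℕ → ℝ}
  {Ng dd : ℕ} {Lr Apk : ℝ}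

/-- **Prop. 2.6's chain ON EVERY REALISED LevelGap GEOMETRY, Lemma 2.1 discharged** — r03's `prop26_chain_2136_tower` with the
tower replaced by an arbitrary contour system realising `g` (`Realizes`, `C.ι` injective, admissible contours exist, walk form
`LevelGap N` of (2.2) with `N ≥ 1`, bond scales, per-scale packing): the (2.61)/(2.63) inputs of `prop26_chain_2136With` at the rate
½δ₂ hold with `c = K261 N dd L A (α·½δ₂)` (`B6Ineq261LevelGap.ineq261With_of_realizes` / `ineq263With_of_realizes`) under
`e^{−α·½δ₂}·L^{2dd/N} < 1`, and (2.54), d(y,y) = 0, d ≥ 0 by `B6Geometry.hyps266_of_realizes`; hence for ANY operators G, G₀, R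
on a finite lattice over 𝔅 with the (2.133)/(2.135)-majorants and G = G₀ + GR, under the located smallness θ·K < 1, G has the
majorant A·K·(1 − θK)⁻¹·P(y)·e^{−δ₃d(y,y′)}, δ₃ = `delta3 α δ₂`.
[cite: Balaban1984PropagatorsII, Prop. 2.6 (2.136), (2.141) p.247; Lemma 2.1 (2.61)–(2.63) p.234, (2.2) p.224] -/
theorem prop26_chain_2136_levelGap (hreal : Realizes g Cs) (hι : Function.Injective Cs.ι) (hconn : Cs.bond.Connected)
    (hgap : LevelGap Cs.bond Cs.zone Ng) (hNg : 0 < Ng) (hbond : BondScale Cs.bond Cs.zone pos ℓ) (hmono : Monotone ℓ)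
    (hℓpos : ∀ n, 0 < ℓ n) (hℓL : ∀ n, ℓ (n + 1) ≤ Lr * ℓ n) (hLr : 1 ≤ Lr) (hApk : 0 ≤ Apk)
    (hpack : ∀ (j : ℕ) (p : Xp) (R : ℝ) (S : Finset Cs.Pt), 0 ≤ R → (∀ v ∈ S, Cs.zone v = j ∧ dist (pos v) p ≤ R) →
      (#S : ℝ) ≤ (2 * R / ℓ j + Apk) ^ dd)
    {δ₂ α θ A : ℝ} (hα : α ≤ 1) (hδ₂ : 0 ≤ δ₂) (hA : 0 ≤ A) (hθ : 0 ≤ θ)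
    (hθK : Real.exp (-(α * (δ₂ / 2))) * Lr ^ ((2 * dd : ℝ) / Ng) < 1)
    {X : Type} [Fintype X] [DecidableEq X] (blk : X → g.Site) (P : g.Site → ℝ) (hP : ∀ y, 0 ≤ P y)
    (hsmall : θ * K261 Ng dd Lr Apk (α * (δ₂ / 2)) < 1)
    {G G0 Rop : Module.End ℝ (X → ℝ)}
    (hG0 : HasMajorant blk G0 (fun y y' => A * P y * Real.exp (-(δ₂ / 2 * g.dist y y'))))
    (hR : HasMajorant blk Rop (fun y y' => θ * Real.exp (-(δ₂ / 2 * g.dist y y'))))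
    (hfix : G = G0 + G * Rop) :
    HasMajorant blk G (fun y y' => A * K261 Ng dd Lr Apk (α * (δ₂ / 2)) *
      (1 - θ * K261 Ng dd Lr Apk (α * (δ₂ / 2)))⁻¹ * P y * Real.exp (-(delta3 α δ₂ * g.dist y y'))) := by
  obtain ⟨htri, hrefl, hdnn⟩ := hyps266_of_realizes hreal hconn
  have hK := partialSum_le_K261 (N := Ng) (dd := dd) (σ := α * (δ₂ / 2)) (by linarith) hApk
    (summable_K261 hNg hLr hApk hθK)
  have h261 : Ineq261With (K261 Ng dd Lr Apk (α * (δ₂ / 2))) g (δ₂ / 2) α :=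
    ineq261With_of_realizes hreal hι hconn hgap hNg hbond hmono hℓpos hℓL hLr hApk hpack hK
  have h263 : Ineq263With (K261 Ng dd Lr Apk (α * (δ₂ / 2))) g (δ₂ / 2) α :=
    ineq263With_of_realizes hreal hι hconn hgap hNg hbond hmono hℓpos hℓL hLr hApk hpack (by linarith) hα hK
  have hc : 0 ≤ K261 Ng dd Lr Apk (α * (δ₂ / 2)) := K261_nonneg (by linarith) hApk
  exact prop26_chain_2136With blk _ δ₂ α θ A P hc hA hP hθ hα hδ₂ htri hrefl hdnn h261 h263 hsmall hG0 hR hfix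

/-- **One entry of (2.136) for a left factor D ON EVERY REALISED LevelGap GEOMETRY, Lemma 2.1 discharged** (rate δ ≥ 0,
α ≤ 1; constant `K = K261 N dd L A (αδ)` under `e^{−αδ}L^{2dd/N} < 1`): from (2.91) `Δ_aG₀ = I − R`, `GΔ_a = I`, the
(2.133)-majorant of DG₀ and the (2.135)-majorant of R only (r03's `prop26_entry_of_291With` / `prop26_entry_of_291_tower`).
[cite: Balaban1984PropagatorsII, Prop. 2.6 (2.136) p.247; (2.91) p.239; Lemma 2.1 (2.61)–(2.63) p.234] -/
theorem prop26_entry_of_291_levelGap (hreal : Realizes g Cs) (hι : Function.Injective Cs.ι) (hconn : Cs.bond.Connected)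
    (hgap : LevelGap Cs.bond Cs.zone Ng) (hNg : 0 < Ng) (hbond : BondScale Cs.bond Cs.zone pos ℓ) (hmono : Monotone ℓ)
    (hℓpos : ∀ n, 0 < ℓ n) (hℓL : ∀ n, ℓ (n + 1) ≤ Lr * ℓ n) (hLr : 1 ≤ Lr) (hApk : 0 ≤ Apk)
    (hpack : ∀ (j : ℕ) (p : Xp) (R : ℝ) (S : Finset Cs.Pt), 0 ≤ R → (∀ v ∈ S, Cs.zone v = j ∧ dist (pos v) p ≤ R) →
      (#S : ℝ) ≤ (2 * R / ℓ j + Apk) ^ dd)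
    {δ α θ A : ℝ} (hα : α ≤ 1) (hδ : 0 ≤ δ) (hA : 0 ≤ A) (hθ : 0 ≤ θ)
    (hθK : Real.exp (-(α * δ)) * Lr ^ ((2 * dd : ℝ) / Ng) < 1)
    {X : Type} [Fintype X] [DecidableEq X] (blk : X → g.Site) (P : g.Site → ℝ) (hP : ∀ y, 0 ≤ P y)
    (hsmall : θ * K261 Ng dd Lr Apk (α * δ) < 1)
    {G G0 Rop Δa : Module.End ℝ (X → ℝ)} (D : Module.End ℝ (X → ℝ))
    (hinv : G * Δa = 1) (h291 : Δa * G0 = 1 - Rop)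
    (hDG0 : HasMajorant blk (D * G0) (fun y y' => A * P y * Real.exp (-(δ * g.dist y y'))))
    (hR : HasMajorant blk Rop (fun y y' => θ * Real.exp (-(δ * g.dist y y')))) :
    HasMajorant blk (D * G) (fun y y' => A * K261 Ng dd Lr Apk (α * δ) * (1 - θ * K261 Ng dd Lr Apk (α * δ))⁻¹ * P y *
      Real.exp (-((1 - α) * δ * g.dist y y'))) := by
  obtain ⟨htri, hrefl, hdnn⟩ := hyps266_of_realizes hreal hconn
  have hK := partialSum_le_K261 (N := Ng) (dd := dd) (σ := α * δ) (by linarith) hApk (summable_K261 hNg hLr hApk hθK)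
  have h261 : Ineq261With (K261 Ng dd Lr Apk (α * δ)) g δ α :=
    ineq261With_of_realizes hreal hι hconn hgap hNg hbond hmono hℓpos hℓL hLr hApk hpack hK
  have h263 : Ineq263With (K261 Ng dd Lr Apk (α * δ)) g δ α :=
    ineq263With_of_realizes hreal hι hconn hgap hNg hbond hmono hℓpos hℓL hLr hApk hpack hδ hα hK
  have hc : 0 ≤ K261 Ng dd Lr Apk (α * δ) := K261_nonneg (by linarith) hApk
  have hαδ : 0 ≤ (1 - α) * δ := mul_nonneg (by linarith) hδ
  exact prop26_entry_of_291With blk _ δ α θ A P hc hA hP hθ hαδ htri hrefl hdnn h261 h263 hsmall D hinv h291 hDG0 hR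

/-- **The two convolution inputs of Cor. 2.8 / (2.88) ON EVERY REALISED LevelGap GEOMETRY, Lemma 2.1 discharged**: (2.63) with
one and with two intermediate points at any rate δ₀ ≥ 0, α ≤ 1, constants `K²` and `K³`, `K = K261 N dd L A (αδ₀)` under
`e^{−αδ₀}L^{2dd/N} < 1` — the `Conv263` / `Conv3` hypotheses of `B6Cor28.cor28_first_conjunct_shape` / `B6Cor28.ineq288_kernel`
(r03's `cor28_conv_tower`). [cite: Balaban1984PropagatorsII, Lemma 2.1 (2.63) p.234; Cor. 2.8 p.249; (2.88) p.238] -/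
theorem cor28_conv_levelGap (hreal : Realizes g Cs) (hι : Function.Injective Cs.ι) (hconn : Cs.bond.Connected)
    (hgap : LevelGap Cs.bond Cs.zone Ng) (hNg : 0 < Ng) (hbond : BondScale Cs.bond Cs.zone pos ℓ) (hmono : Monotone ℓ)
    (hℓpos : ∀ n, 0 < ℓ n) (hℓL : ∀ n, ℓ (n + 1) ≤ Lr * ℓ n) (hLr : 1 ≤ Lr) (hApk : 0 ≤ Apk)
    (hpack : ∀ (j : ℕ) (p : Xp) (R : ℝ) (S : Finset Cs.Pt), 0 ≤ R → (∀ v ∈ S, Cs.zone v = j ∧ dist (pos v) p ≤ R) →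
      (#S : ℝ) ≤ (2 * R / ℓ j + Apk) ^ dd)
    {δ₀ α : ℝ} (hα : α ≤ 1) (hδ₀ : 0 ≤ δ₀) (hθK : Real.exp (-(α * δ₀)) * Lr ^ ((2 * dd : ℝ) / Ng) < 1) :
    B6Cor28.Conv263 g.dist δ₀ (K261 Ng dd Lr Apk (α * δ₀) ^ 2) ((1 - α) * δ₀) ∧
      B6Cor28.Conv3 g.dist δ₀ (K261 Ng dd Lr Apk (α * δ₀) ^ 3) ((1 - α) * δ₀) := by
  have hK := partialSum_le_K261 (N := Ng) (dd := dd) (σ := α * δ₀) (by linarith) hApk (summable_K261 hNg hLr hApk hθK)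
  have h263 : Ineq263With (K261 Ng dd Lr Apk (α * δ₀)) g δ₀ α :=
    ineq263With_of_realizes hreal hι hconn hgap hNg hbond hmono hℓpos hℓL hLr hApk hpack hδ₀ hα hK
  exact ⟨conv263_of_ineq263With _ _ δ₀ α h263, conv3_of_ineq263With _ _ δ₀ α h263⟩

open B6Prop26Gluing (mulOp LocalMajorant OutLoc) in
open Classical in
/-- **The end-to-end glueing (2.133) + (2.134) + (2.91) ⟹ (2.136) ON EVERY REALISED LevelGap GEOMETRY, Lemma 2.1 discharged**
(r03's `prop26_2136_of_2133_2134_tower` off the towers): for ANY family of boxes 𝒟 with reaches S_□ of overlap number N′ over 𝔅,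
partition functions h_□ (|h_□| ≤ 1, supported in S_□), box operators G_□ with the (2.133)-type local bound A·P(y)·e^{−½δ₂d} on
S_□, pair operators K_{□,□′} output-localised to S_□ with (2.134) at θ₀, G₀ = Σ_□ h_□G_□h_□, R = Σ K_{□,□′}h_{□′}, (2.91) and
GΔ_a = I, under the located smallness N′²θ₀·K < 1 (`K = K261 N dd L A (α·½δ₂)`, `e^{−α·½δ₂}L^{2dd/N} < 1`):
|G(x,x′)| ≤ (N′·A)·K·(1 − N′²θ₀K)⁻¹·P(y)·e^{−δ₃d(y,y′)}, δ₃ = `delta3 α δ₂`.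
[cite: Balaban1984PropagatorsII, Prop. 2.6 (2.136) p.247; (2.91) p.239; (2.133)–(2.135) p.247; Lemma 2.1 (2.61)–(2.63) p.234] -/
theorem prop26_2136_of_2133_2134_levelGap (hreal : Realizes g Cs) (hι : Function.Injective Cs.ι)
    (hconn : Cs.bond.Connected) (hgap : LevelGap Cs.bond Cs.zone Ng) (hNg : 0 < Ng)
    (hbond : BondScale Cs.bond Cs.zone pos ℓ) (hmono : Monotone ℓ) (hℓpos : ∀ n, 0 < ℓ n)
    (hℓL : ∀ n, ℓ (n + 1) ≤ Lr * ℓ n) (hLr : 1 ≤ Lr) (hApk : 0 ≤ Apk)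
    (hpack : ∀ (j : ℕ) (p : Xp) (R : ℝ) (S : Finset Cs.Pt), 0 ≤ R → (∀ v ∈ S, Cs.zone v = j ∧ dist (pos v) p ≤ R) →
      (#S : ℝ) ≤ (2 * R / ℓ j + Apk) ^ dd)
    {δ₂ α θ₀ A : ℝ} (hα : α ≤ 1) (hδ₂ : 0 ≤ δ₂) (hA : 0 ≤ A) (hθ₀ : 0 ≤ θ₀)
    (hθK : Real.exp (-(α * (δ₂ / 2))) * Lr ^ ((2 * dd : ℝ) / Ng) < 1)
    {X : Type} [Fintype X] [DecidableEq X] (blk : X → g.Site) (P : g.Site → ℝ) (hP : ∀ y, 0 ≤ P y)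
    {C : Type} (D : Finset C) (S : C → Set g.Site) (N : ℕ)
    (hN : ∀ y : g.Site, (D.filter fun i => y ∈ S i).card ≤ N)
    (hsmall : (N : ℝ) ^ 2 * θ₀ * K261 Ng dd Lr Apk (α * (δ₂ / 2)) < 1)
    (h : C → X → ℝ) (hsupp : ∀ i ∈ D, ∀ x, h i x ≠ 0 → blk x ∈ S i) (hle : ∀ i ∈ D, ∀ x, |h i x| ≤ 1)
    (Gl : C → Module.End ℝ (X → ℝ))
    (h2133 : ∀ i ∈ D, LocalMajorant blk (Gl i) (S i) (fun y y' => A * P y * Real.exp (-(δ₂ / 2 * g.dist y y'))))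
    (Kt : C → C → Module.End ℝ (X → ℝ))
    (h2134 : ∀ i ∈ D, ∀ i' ∈ D, HasMajorant blk (Kt i i' * mulOp (h i'))
      (fun y y' => θ₀ * Real.exp (-(δ₂ / 2 * g.dist y y'))))
    (hKout : ∀ i ∈ D, ∀ i' ∈ D, OutLoc blk (Kt i i') (S i))
    {G G0 Rop Δa : Module.End ℝ (X → ℝ)}
    (hG0 : G0 = ∑ i ∈ D, mulOp (h i) * Gl i * mulOp (h i))
    (hR : Rop = ∑ i ∈ D, ∑ i' ∈ D, Kt i i' * mulOp (h i'))
    (hinv : G * Δa = 1) (h291 : Δa * G0 = 1 - Rop) :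
    HasMajorant blk G (fun y y' => (N * A) * K261 Ng dd Lr Apk (α * (δ₂ / 2)) *
      (1 - (N : ℝ) ^ 2 * θ₀ * K261 Ng dd Lr Apk (α * (δ₂ / 2)))⁻¹ * P y *
      Real.exp (-(delta3 α δ₂ * g.dist y y'))) := by
  obtain ⟨htri, hrefl, hdnn⟩ := hyps266_of_realizes hreal hconn
  have hK := partialSum_le_K261 (N := Ng) (dd := dd) (σ := α * (δ₂ / 2)) (by linarith) hApk
    (summable_K261 hNg hLr hApk hθK)
  have h261 : Ineq261With (K261 Ng dd Lr Apk (α * (δ₂ / 2))) g (δ₂ / 2) α :=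
    ineq261With_of_realizes hreal hι hconn hgap hNg hbond hmono hℓpos hℓL hLr hApk hpack hK
  have h263 : Ineq263With (K261 Ng dd Lr Apk (α * (δ₂ / 2))) g (δ₂ / 2) α :=
    ineq263With_of_realizes hreal hι hconn hgap hNg hbond hmono hℓpos hℓL hLr hApk hpack (by linarith) hα hK
  have hc : 0 ≤ K261 Ng dd Lr Apk (α * (δ₂ / 2)) := K261_nonneg (by linarith) hApk
  exact prop26_2136_of_2133_2134With blk _ δ₂ α θ₀ A P hc hA hP hθ₀ hα hδ₂ htri hrefl hdnn h261 h263 D S N hN hsmall h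
    hsupp hle Gl h2133 Kt h2134 hKout hG0 hR hinv h291

end

end Literature.MathematicalPhysics.QuantumFieldTheory.Balaban1983to89.B6Prop26ChainLevelGap
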